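import Mathlib
import Summits.RiemannHypothesis.RiemannHypothesis.Theorems.WeilFarFloorCoshSplitRH
import Summits.RiemannHypothesis.RiemannHypothesis.Theorems.WeilFarFloorCoshTest
import HarnessLib

/-!
# Splitting a window function along a profile: `u = c·f + r`, `r ⊥ f`

Helper file (`--supports stmt-RiemannHypothesis-0098`, lead-track anchor: Weil-positivity window ladder, format-C far bound),
pure proofs, RH-free.  Seat rh-explicit-weil-1 gen12 (memo `run/shared/lean/pub/rh-explicit/rh-explicit-weil-1/FORMAT-K3.md` §13.7):
toolkit for stage 3 of C-XIII″ («under RH the cosh test is asymptotically THE extremal»).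

For admissible `u, f` on `[−B, B]` (real, measurable, bounded, vanishing off the window) with `∫f² > 0`, put
`c = ∫uf/∫f²` and `r = u − c·f`.  Then (all elementary):
* `integral_profile_mul_residual` : `∫ f·r = 0`;  `integral_sq_eq_profile_add_residual` : `∫u² = c²∫f² + ∫r²` (Pythagoras), hence
  `c²∫f² ≤ ∫u²` (Bessel) and `∫r² ≤ ∫u²`;
* `residual_admissible` : `r` is admissible on `[−B, B]` (any real `c`);
* `sq_integral_residual_mul_le` : for any admissible `w` on `[−B, B]`, `(∫ r·w)² ≤ ∫r² · ∫(w − f)²` — the residual only sees the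
  DISTANCE of `w` to the profile (use: `w = cosh(·/2)·1_{[−B,B]}`, `f` = a mollified cosh profile ⟹ the pole term `2(∫r cosh)²` is tiny);
* `integral_sq_shiftAdd_residual_le` : `D_t(r) ≤ 2D_t(u) + 2c²D_t(f)` (`D_t(g) = ∫(g(x+t) − g(x))²`; any real `c`): the residual
  inherits the `L²`-moduli of continuity of `u` and of the profile;
* `sq_proj_div_sub_le` : `(∫uf)²/∫f² − (∫ug)²/∫g² ≤ 3∫u²·‖f − g‖₂/‖f‖₂` when `∫g² ≤ ∫f²`, `‖f−g‖ ≤ ‖f‖` — the projection energy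
  moves little when the profile is mollified (transfers the profile rigidity of `WeilFarFloorProfileRigidityRH` from `C_b` to `C_b ∗ ψ_ε`);
* `sq_integral_residual_mul_cosh_le` : `(∫ r cosh(·/2))² ≤ ∫r² · ∫(C_B − f)²` — the residual's POLE coupling is tiny for `f ≈ C_B`.
Standard axioms only.
-/

set_option linter.dupNamespace false
set_option autoImplicit false

noncomputable section

open MeasureTheory Set Filter
open scoped Real Topology ArithmeticFunction.vonMangoldt

namespace Summit.RiemannHypothesis.RiemannHypothesis.Theorems.WeilFormatC

namespace FloorCoshSplit

open Literature.NumberTheory.LFunctions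

variable {B : ℝ} {u f w : ℝ → ℝ} {Cu Cf Cw : ℝ}

/-! ## §1 Products of admissible functions -/

/-- `∫ g·h` makes sense: the product of two admissible functions on `[−B, B]` is integrable. -/
theorem integrable_admissible_mul (hu : Measurable u) (hf : Measurable f) (hCu : ∀ x, |u x| ≤ Cu) (hCf : ∀ x, |f x| ≤ Cf)
    (hus : ∀ x, x ∉ Icc (-B) B → u x = 0) : Integrable fun x ↦ u x * f x :=
  (FloorSmoothing.integrable_shift_mul_shift_left hu hf hCu hCf hus 0 0).congr
    (Eventually.of_forall fun x ↦ by simp only [sub_zero])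

/-- Cauchy–Schwarz for two admissible functions: `(∫ u f)² ≤ ∫u² · ∫f²`. -/
theorem sq_integral_admissible_mul_le (hu : Measurable u) (hf : Measurable f) (hCu : ∀ x, |u x| ≤ Cu) (hCf : ∀ x, |f x| ≤ Cf)
    (hus : ∀ x, x ∉ Icc (-B) B → u x = 0) (hfs : ∀ x, x ∉ Icc (-B) B → f x = 0) :
    (∫ x, u x * f x) ^ 2 ≤ (∫ x, u x ^ 2) * ∫ x, f x ^ 2 :=
  FloorSmoothing.sq_integral_mul_le
    ((integrable_admissible_mul hu hu hCu hCu hus).congr (Eventually.of_forall fun x ↦ by simp only; ring))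
    (integrable_admissible_mul hu hf hCu hCf hus)
    ((integrable_admissible_mul hf hf hCf hCf hfs).congr (Eventually.of_forall fun x ↦ by simp only; ring))

/-! ## §2 The residual `r = u − c·f` -/

/-- **The residual is admissible** on `[−B, B]`: measurable, bounded by `sup|u| + |c|·sup|f|`, vanishing off the window. -/
theorem residual_admissible (hu : Measurable u) (hf : Measurable f) (hCu : ∀ x, |u x| ≤ Cu) (hCf : ∀ x, |f x| ≤ Cf)
    (hus : ∀ x, x ∉ Icc (-B) B → u x = 0) (hfs : ∀ x, x ∉ Icc (-B) B → f x = 0) (c : ℝ) :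
    Measurable (fun x ↦ u x - c * f x) ∧ (∀ x, |u x - c * f x| ≤ Cu + |c| * Cf) ∧
      (∀ x, x ∉ Icc (-B) B → u x - c * f x = 0) := by
  refine ⟨hu.sub (hf.const_mul c), fun x ↦ ?_, fun x hx ↦ by rw [hus x hx, hfs x hx, mul_zero, sub_zero]⟩
  calc |u x - c * f x| ≤ |u x| + |c * f x| := abs_sub _ _
    _ ≤ Cu + |c| * Cf := by rw [abs_mul]; exact add_le_add (hCu x) (mul_le_mul_of_nonneg_left (hCf x) (abs_nonneg c))

/-- **Orthogonality**: with `c = ∫uf/∫f²` (`∫f² ≠ 0`), `∫ f·(u − c f) = 0`. -/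
theorem integral_profile_mul_residual (hu : Measurable u) (hf : Measurable f) (hCu : ∀ x, |u x| ≤ Cu) (hCf : ∀ x, |f x| ≤ Cf)
    (hus : ∀ x, x ∉ Icc (-B) B → u x = 0) (hfs : ∀ x, x ∉ Icc (-B) B → f x = 0) (hf0 : ∫ x, f x ^ 2 ≠ 0) :
    ∫ x, f x * (u x - (∫ y, u y * f y) / (∫ y, f y ^ 2) * f x) = 0 := by
  have iuf := integrable_admissible_mul hu hf hCu hCf hus
  have iff' : Integrable fun x ↦ f x ^ 2 :=
    (integrable_admissible_mul hf hf hCf hCf hfs).congr (Eventually.of_forall fun x ↦ by simp only; ring)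
  have e : (fun x ↦ f x * (u x - (∫ y, u y * f y) / (∫ y, f y ^ 2) * f x))
      = fun x ↦ u x * f x - (∫ y, u y * f y) / (∫ y, f y ^ 2) * f x ^ 2 := funext fun x ↦ by ring
  rw [e, integral_sub iuf (iff'.const_mul _), integral_const_mul, div_mul_cancel₀ _ hf0, sub_self]

/-- **Pythagoras**: `∫u² = c²∫f² + ∫(u − cf)²` for `c = ∫uf/∫f²`. -/
theorem integral_sq_eq_profile_add_residual (hu : Measurable u) (hf : Measurable f) (hCu : ∀ x, |u x| ≤ Cu)
    (hCf : ∀ x, |f x| ≤ Cf) (hus : ∀ x, x ∉ Icc (-B) B → u x = 0) (hfs : ∀ x, x ∉ Icc (-B) B → f x = 0)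
    (hf0 : ∫ x, f x ^ 2 ≠ 0) :
    ∫ x, u x ^ 2 = ((∫ y, u y * f y) / ∫ y, f y ^ 2) ^ 2 * (∫ x, f x ^ 2)
      + ∫ x, (u x - (∫ y, u y * f y) / (∫ y, f y ^ 2) * f x) ^ 2 := by
  set c := (∫ y, u y * f y) / ∫ y, f y ^ 2 with hc
  have iuf := integrable_admissible_mul hu hf hCu hCf hus
  have iuu : Integrable fun x ↦ u x ^ 2 :=
    (integrable_admissible_mul hu hu hCu hCu hus).congr (Eventually.of_forall fun x ↦ by simp only; ring)
  have iff' : Integrable fun x ↦ f x ^ 2 :=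
    (integrable_admissible_mul hf hf hCf hCf hfs).congr (Eventually.of_forall fun x ↦ by simp only; ring)
  have e : (fun x ↦ (u x - c * f x) ^ 2) = fun x ↦ u x ^ 2 - 2 * c * (u x * f x) + c ^ 2 * f x ^ 2 :=
    funext fun x ↦ by ring
  have i3 : Integrable fun x ↦ 2 * c * (u x * f x) := iuf.const_mul _
  have i1 : Integrable fun x ↦ u x ^ 2 - 2 * c * (u x * f x) := iuu.sub i3
  have i2 : Integrable fun x ↦ c ^ 2 * f x ^ 2 := iff'.const_mul _
  rw [e, integral_add i1 i2, integral_sub iuu i3, integral_const_mul, integral_const_mul]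
  have hcf : c * ∫ x, f x ^ 2 = ∫ x, u x * f x := by rw [hc, div_mul_cancel₀ _ hf0]
  linear_combination (-2 * c) * hcf

/-- **Bessel**: `c²∫f² ≤ ∫u²` and `∫(u − cf)² ≤ ∫u²` for `c = ∫uf/∫f²`. -/
theorem profile_energy_le (hu : Measurable u) (hf : Measurable f) (hCu : ∀ x, |u x| ≤ Cu) (hCf : ∀ x, |f x| ≤ Cf)
    (hus : ∀ x, x ∉ Icc (-B) B → u x = 0) (hfs : ∀ x, x ∉ Icc (-B) B → f x = 0) (hf0 : ∫ x, f x ^ 2 ≠ 0) :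
    ((∫ y, u y * f y) / ∫ y, f y ^ 2) ^ 2 * (∫ x, f x ^ 2) ≤ ∫ x, u x ^ 2 ∧
      ∫ x, (u x - (∫ y, u y * f y) / (∫ y, f y ^ 2) * f x) ^ 2 ≤ ∫ x, u x ^ 2 := by
  have h := integral_sq_eq_profile_add_residual hu hf hCu hCf hus hfs hf0
  have h1 : 0 ≤ ∫ x, (u x - (∫ y, u y * f y) / (∫ y, f y ^ 2) * f x) ^ 2 := integral_nonneg fun x ↦ sq_nonneg _
  have h2 : 0 ≤ ((∫ y, u y * f y) / ∫ y, f y ^ 2) ^ 2 * (∫ x, f x ^ 2) :=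
    mul_nonneg (sq_nonneg _) (integral_nonneg fun x ↦ sq_nonneg _)
  constructor <;> linarith

/-! ## §3 The residual only sees the distance to the profile -/

/-- **`(∫ r·w)² ≤ ∫r² · ∫(w − f)²`** for the residual `r = u − cf` (`c = ∫uf/∫f²`) and ANY admissible `w` on `[−B, B]`:
by orthogonality `∫ r w = ∫ r (w − f)`, then Cauchy–Schwarz. -/
theorem sq_integral_residual_mul_le (hu : Measurable u) (hf : Measurable f) (hw : Measurable w) (hCu : ∀ x, |u x| ≤ Cu)
    (hCf : ∀ x, |f x| ≤ Cf) (hCw : ∀ x, |w x| ≤ Cw) (hus : ∀ x, x ∉ Icc (-B) B → u x = 0)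
    (hfs : ∀ x, x ∉ Icc (-B) B → f x = 0) (hws : ∀ x, x ∉ Icc (-B) B → w x = 0) (hf0 : ∫ x, f x ^ 2 ≠ 0) :
    (∫ x, (u x - (∫ y, u y * f y) / (∫ y, f y ^ 2) * f x) * w x) ^ 2
      ≤ (∫ x, (u x - (∫ y, u y * f y) / (∫ y, f y ^ 2) * f x) ^ 2) * ∫ x, (w x - f x) ^ 2 := by
  set c := (∫ y, u y * f y) / ∫ y, f y ^ 2 with hc
  obtain ⟨hrm, hrb, hrs⟩ := residual_admissible hu hf hCu hCf hus hfs c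
  obtain ⟨hdm, hdb, hds⟩ : Measurable (fun x ↦ w x - f x) ∧ (∀ x, |w x - f x| ≤ Cw + Cf) ∧
      (∀ x, x ∉ Icc (-B) B → w x - f x = 0) :=
    ⟨hw.sub hf, fun x ↦ (abs_sub _ _).trans (add_le_add (hCw x) (hCf x)),
      fun x hx ↦ by rw [hws x hx, hfs x hx, sub_zero]⟩
  have horth : ∫ x, (u x - c * f x) * f x = 0 := by
    rw [← integral_profile_mul_residual hu hf hCu hCf hus hfs hf0]
    exact integral_congr_ae (Eventually.of_forall fun x ↦ by simp only [hc]; ring)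
  have e : ∫ x, (u x - c * f x) * w x = ∫ x, (u x - c * f x) * (w x - f x) := by
    have i1 := integrable_admissible_mul hrm hw hrb hCw hrs
    have i2 := integrable_admissible_mul hrm hf hrb hCf hrs
    have : (fun x ↦ (u x - c * f x) * (w x - f x)) = fun x ↦ (u x - c * f x) * w x - (u x - c * f x) * f x :=
      funext fun x ↦ by ring
    rw [this, integral_sub i1 i2, horth, sub_zero]
  rw [e]
  exact sq_integral_admissible_mul_le hrm hdm hrb hdb hrs hds

/-- A function vanishing off `[−B, B]` integrates against `g` exactly as against `g·1_{[−B,B]}`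
(use: `∫ r(t) cosh(t/2) dt = ∫ r · C_B` with `C_B` the cosh profile of the window). -/
theorem integral_mul_eq_integral_mul_indicator {r : ℝ → ℝ} (hrs : ∀ x, x ∉ Icc (-B) B → r x = 0) (g : ℝ → ℝ) :
    ∫ x, r x * g x = ∫ x, r x * (Icc (-B) B).indicator g x := by
  refine integral_congr_ae (Eventually.of_forall fun x ↦ ?_)
  by_cases hx : x ∈ Icc (-B) B
  · simp only [indicator_of_mem hx]
  · simp only [hrs x hx, zero_mul]

/-! ## §4 The residual inherits the moduli of continuity -/

/-- **`D_t(u − cf) ≤ 2D_t(u) + 2c²D_t(f)`** for admissible `u, f` and any real `c`. -/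
theorem integral_sq_shiftAdd_residual_le (hu : Measurable u) (hf : Measurable f) (hCu : ∀ x, |u x| ≤ Cu)
    (hCf : ∀ x, |f x| ≤ Cf) (hus : ∀ x, x ∉ Icc (-B) B → u x = 0) (hfs : ∀ x, x ∉ Icc (-B) B → f x = 0)
    (c t : ℝ) :
    ∫ x, ((u (x + t) - c * f (x + t)) - (u x - c * f x)) ^ 2
      ≤ 2 * (∫ x, (u (x + t) - u x) ^ 2) + 2 * c ^ 2 * ∫ x, (f (x + t) - f x) ^ 2 := by
  have iu : Integrable fun x ↦ 2 * (u (x + t) - u x) ^ 2 := (integrable_sq_shiftAdd_sub hu hCu hus t).const_mul 2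
  have if' : Integrable fun x ↦ 2 * c ^ 2 * (f (x + t) - f x) ^ 2 :=
    (integrable_sq_shiftAdd_sub hf hCf hfs t).const_mul _
  rw [← integral_const_mul, ← integral_const_mul, ← integral_add iu if']
  refine integral_mono_of_nonneg (Eventually.of_forall fun x ↦ sq_nonneg _) (iu.add if')
    (Eventually.of_forall fun x ↦ ?_)
  nlinarith [sq_nonneg ((u (x + t) - u x) + c * (f (x + t) - f x))]

/-! ## §5 Moving the profile: the projection energy is Lipschitz in the profile -/

/-- **Projection comparison.**  For admissible `u, f, g` with `0 < ∫g² ≤ ∫f²` and `∫(f − g)² ≤ ∫f²`: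
`(∫uf)²/∫f² − (∫ug)²/∫g² ≤ 3·∫u²·√(∫(f−g)²)/√(∫f²)` — replacing the profile `f` by a nearby `g` (a mollification: `∫g² ≤ ∫f²`)
loses at most `3‖u‖²·‖f − g‖/‖f‖` of projection energy (use: transfer of the profile-rigidity bound from `C_b` to its mollification). -/
theorem sq_proj_div_sub_le {g : ℝ → ℝ} {Cg : ℝ} (hu : Measurable u) (hf : Measurable f) (hg : Measurable g)
    (hCu : ∀ x, |u x| ≤ Cu) (hCf : ∀ x, |f x| ≤ Cf) (hCg : ∀ x, |g x| ≤ Cg) (hus : ∀ x, x ∉ Icc (-B) B → u x = 0)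
    (hfs : ∀ x, x ∉ Icc (-B) B → f x = 0) (hgs : ∀ x, x ∉ Icc (-B) B → g x = 0) (hg0 : 0 < ∫ x, g x ^ 2)
    (hgf : ∫ x, g x ^ 2 ≤ ∫ x, f x ^ 2) (hdf : ∫ x, (f x - g x) ^ 2 ≤ ∫ x, f x ^ 2) :
    (∫ x, u x * f x) ^ 2 / (∫ x, f x ^ 2) - (∫ x, u x * g x) ^ 2 / (∫ x, g x ^ 2)
      ≤ 3 * (∫ x, u x ^ 2) * Real.sqrt (∫ x, (f x - g x) ^ 2) / Real.sqrt (∫ x, f x ^ 2) := by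
  set N := ∫ x, u x ^ 2 with hN
  set F := ∫ x, f x ^ 2 with hF
  set G := ∫ x, g x ^ 2 with hG
  set D := ∫ x, (f x - g x) ^ 2 with hD
  set p := ∫ x, u x * f x with hp
  set q := ∫ x, u x * g x with hq
  have hF0 : 0 < F := hg0.trans_le hgf
  have hN0 : 0 ≤ N := integral_nonneg fun x ↦ sq_nonneg _
  have hD0 : 0 ≤ D := integral_nonneg fun x ↦ sq_nonneg _
  -- the difference profile `f − g` is admissible
  obtain ⟨hdm, hdb, hds⟩ : Measurable (fun x ↦ f x - g x) ∧ (∀ x, |f x - g x| ≤ Cf + Cg) ∧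
      (∀ x, x ∉ Icc (-B) B → f x - g x = 0) :=
    ⟨hf.sub hg, fun x ↦ (abs_sub _ _).trans (add_le_add (hCf x) (hCg x)), fun x hx ↦ by rw [hfs x hx, hgs x hx, sub_zero]⟩
  -- `p = q + d`, `d² ≤ N·D`, `q² ≤ N·G`
  set d := ∫ x, u x * (f x - g x) with hd
  have hpq : p = q + d := by
    rw [hp, hq, hd, ← integral_add (integrable_admissible_mul hu hg hCu hCg hus) (integrable_admissible_mul hu hdm hCu hdb hus)]
    exact integral_congr_ae (Eventually.of_forall fun x ↦ by ring)
  have hd2 : d ^ 2 ≤ N * D := sq_integral_admissible_mul_le hu hdm hCu hdb hus hds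
  have hq2 : q ^ 2 ≤ N * G := sq_integral_admissible_mul_le hu hg hCu hCg hus hgs
  -- square roots
  set δ := Real.sqrt D with hδ
  set φ := Real.sqrt F with hφ
  have hδ0 : 0 ≤ δ := Real.sqrt_nonneg _
  have hφ0 : 0 < φ := Real.sqrt_pos.2 hF0
  have hδφ : δ ≤ φ := Real.sqrt_le_sqrt hdf
  have hDδ : D = δ ^ 2 := (Real.sq_sqrt hD0).symm
  have hFφ : F = φ ^ 2 := (Real.sq_sqrt hF0.le).symm
  have habsd : |d| ≤ Real.sqrt N * δ := by
    rw [← Real.sqrt_sq_eq_abs, hδ, ← Real.sqrt_mul hN0]; exact Real.sqrt_le_sqrt hd2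
  have habsq : |q| ≤ Real.sqrt N * φ := by
    rw [← Real.sqrt_sq_eq_abs, hφ, ← Real.sqrt_mul hN0]; exact Real.sqrt_le_sqrt (hq2.trans (mul_le_mul_of_nonneg_left hgf hN0))
  have hNN : Real.sqrt N * Real.sqrt N = N := Real.mul_self_sqrt hN0
  -- `p²/F − q²/G ≤ (2|q||d| + d²)/F ≤ 3Nφδ/F = 3Nδ/φ`
  have h1 : p ^ 2 / F - q ^ 2 / G ≤ (2 * |q| * |d| + d ^ 2) / F := by
    have hqG : q ^ 2 / F ≤ q ^ 2 / G := div_le_div_of_nonneg_left (sq_nonneg _) hg0 hgf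
    have hqd : q * d ≤ |q| * |d| := by rw [← abs_mul]; exact le_abs_self _
    have hp2 : p ^ 2 ≤ q ^ 2 + (2 * |q| * |d| + d ^ 2) := by
      rw [hpq]; nlinarith [hqd, sq_abs d]
    have := div_le_div_of_nonneg_right hp2 hF0.le
    rw [add_div] at this
    linarith
  have h2 : 2 * |q| * |d| + d ^ 2 ≤ 3 * N * φ * δ := by
    have hm : |q| * |d| ≤ (Real.sqrt N * φ) * (Real.sqrt N * δ) :=
      mul_le_mul habsq habsd (abs_nonneg _) (mul_nonneg (Real.sqrt_nonneg _) hφ0.le)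
    have e : (Real.sqrt N * φ) * (Real.sqrt N * δ) = N * φ * δ := by
      rw [show (Real.sqrt N * φ) * (Real.sqrt N * δ) = (Real.sqrt N * Real.sqrt N) * φ * δ by ring, hNN]
    rw [e] at hm
    have e2 : d ^ 2 ≤ N * φ * δ := hd2.trans (by rw [hDδ]; nlinarith [mul_nonneg hN0 hδ0])
    linarith
  calc p ^ 2 / F - q ^ 2 / G ≤ (2 * |q| * |d| + d ^ 2) / F := h1
    _ ≤ 3 * N * φ * δ / F := div_le_div_of_nonneg_right h2 hF0.le
    _ = 3 * N * δ / φ := by rw [hFφ]; field_simp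

/-! ## §6 The pole term of the residual -/

/-- **The residual's pole coupling**: for `r = u − cf` on `[−B, B]` (`c = ∫uf/∫f²`),
`(∫ r(t)·cosh(t/2) dt)² ≤ ∫r² · ∫(C_B − f)²` with `C_B = cosh(·/2)·1_{[−B,B]}` the cosh profile of the window. -/
theorem sq_integral_residual_mul_cosh_le (hu : Measurable u) (hf : Measurable f) (hCu : ∀ x, |u x| ≤ Cu)
    (hCf : ∀ x, |f x| ≤ Cf) (hus : ∀ x, x ∉ Icc (-B) B → u x = 0) (hfs : ∀ x, x ∉ Icc (-B) B → f x = 0)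
    (hf0 : ∫ x, f x ^ 2 ≠ 0) :
    (∫ x, (u x - (∫ y, u y * f y) / (∫ y, f y ^ 2) * f x) * Real.cosh (x / 2)) ^ 2
      ≤ (∫ x, (u x - (∫ y, u y * f y) / (∫ y, f y ^ 2) * f x) ^ 2)
        * ∫ x, ((Icc (-B) B).indicator (fun y ↦ Real.cosh (y / 2)) x - f x) ^ 2 := by
  obtain ⟨hCm, hCb, hCs⟩ := FloorCosh.coshTest_admissible B
  obtain ⟨-, -, hrs⟩ := residual_admissible hu hf hCu hCf hus hfs ((∫ y, u y * f y) / ∫ y, f y ^ 2)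
  rw [integral_mul_eq_integral_mul_indicator hrs (fun x ↦ Real.cosh (x / 2))]
  exact sq_integral_residual_mul_le hu hf hCm hCu hCf hCb hus hfs hCs hf0

end FloorCoshSplit

end Summit.RiemannHypothesis.RiemannHypothesis.Theorems.WeilFormatC
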